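/-
Copyright (c) 2026 the pub-hodgecm-mathlib formalisation cell (harness21).  Prover seat hodgecm-mathlib-K2Liu-p09 (g0): Track B «K2-LIT»,
#184♮ = hLiu418 = stmt-HodgeConjecture-24832, file #9 of the K2_Liu road, organ (III-b) step E5′ (A2: the abstract Godement lemma); 2026-09-04.
-/
import Literature.MeasureTheory.Group.ModularCharacterSemidirect          -- ★ `IsTopSemidirect.map_conjBy_eq_smul`, `lintegral_eq_mul_lintegral_prod`
import Literature.MeasureTheory.Group.CoveringWeights                     -- ★ covering weights, domination by a covering set
import Literature.MeasureTheory.Group.HaarRightInvariantCompactSubgroup   -- ★ `modularCharacter_eq_one_of_mem_isCompact`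
import Literature.NumberTheory.Automorphic.AdelicUnitaryGroupUnimodular   -- ★ `continuous_modularCharacter`
import Summits.HodgeConjecture.HodgeConjecture.Theorems.K2LiuGodementSiegelShellIntegral   -- ★ A1: shell integral, `k!`-trick
import HarnessLib

/-!
# Crux `HLiu418`, Track B road `K2_Liu`, unit U3a «SIEGEL EISENSTEIN SERIES», file #9 — helper 13 (organ (III-b), step E5′, part A2):
# GODEMENT'S LEMMA for a parabolic `P = M ⋉ N` with Levi `M ≅ GL_k(𝔸_K)` — the parabolic integral `∫_{Γ_P \ P} 𝟙{χ ≤ C} χ^τ` is finite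

Cell `hodgecm-mathlib`, crux item hLiu418 = `stmt-HodgeConjecture-24832`; squad K2 ∕ K2Liu, prover K2Liu-p09 (g0).  THEOREMS ONLY; lane
`--supports stmt-HodgeConjecture-24832` (count-neutral helper: the ABSTRACT form of the single remaining stub E5′ «parabolic integral on
`P_Δ(𝔸)`» of the skeleton of record for socket #9 `sig_K2LiuSiegelEisensteinDoubledSummable`; PLAN v3 §A2).

**Theorem `godement_parabolic_integral`.**  Let `B` be a second countable locally compact group, `B = A ⋉ N` an internal topological
semidirect product (★ `IsTopSemidirect A N e`), `Γ ≤ B` discrete countable, `φ : GL_k(𝔸_K) ≃ₜ* A` (`k ≥ 1`) with `φ(GL_k(K)) ⊆ Γ`,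
`χ : B → ℝ` measurable with `χ(a n) = χ(a)`, `χ(γ b) = χ(b)` (`γ ∈ Γ`) and `χ(φ g) = |det g|^{e}` (`e > 0`), `C_N ⊆ N` compact with
`N = (Γ ∩ N) · C_N`, and suppose the Levi action on a Haar measure `μ_N` of `N` scales along the split centre as
`(φ z(eˢ))⁻¹ · (φ z(eˢ))_* μ_N = e^{c₀ s} μ_N`.  If `c₀ < k [K:ℚ] e τ` (`τ ≥ 0`) then for a Haar measure `μ_B` and a `Γ`-covering weight `w`:
`∫⁻_B 𝟙{χ ≤ C₁} χ^τ w dμ_B < ∞` for every `C₁`.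

Proof (Godement, Sém. Bourbaki 257 §8; Garrett (2018) §3.10; Moeglin–Waldspurger II.1.5).  (1) The integrand is left `Γ`-invariant, so the
weight is dominated by the covering SET `S = C_N · φ(A_G Ω̄ A_{T₀}(t) K)` (reduction theory ★ `reductionTheory_gl_holds` for the Levi and the
compact `C_N` for `N`; ★ `lintegral_mul_le_inv_mul_setLIntegral_of_le_coveringSum_indicator`).  (2) In semidirect coordinates `b = a n`
(★ `IsTopSemidirect.lintegral_eq_mul_lintegral_prod`) the fibre of `S` over `a ∈ φ(A_G 𝔖)` is `a⁻¹ C_N a`, of measure `θ(a⁻¹) μ_N(C_N)` with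
`θ = Δ_B|_A / Δ_A` the module of the Levi action (★ `IsTopSemidirect.map_conjBy_eq_smul`).  (3) `θ ∘ φ` is a continuous character of `GL_k(𝔸_K)`
(★ `continuous_modularCharacter`), trivial on `K` (★ `modularCharacter_eq_one_of_mem_isCompact`) and on the Siegel cone (the `k!`-trick
★ `map_glDiagonal_eq_one_of_prod_eq_one` — no computation), bounded on `Ω̄`, and `= e^{c₀ s}` on `z(eˢ)`; so ★ A1
`setLIntegral_center_mul_siegel_rpow_mul_lt_top` sums the centre shells.

HONEST LABEL.  Count-neutral helper of the K2_Liu road; it retires nothing by itself: `HC_CM` is proved only modulo the 7 printed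
citations (2 remaining named inputs: hLiu418 = `stmt-HodgeConjecture-24832`, h413 = `stmt-HodgeConjecture-24833`) until rung 0 closes.

## References
* [Godement1964] R. Godement, *Domaines fondamentaux des groupes arithmétiques*, Sém. Bourbaki 257 (1962/63), §8.
* [Garrett2018] P. Garrett, *Modern Analysis of Automorphic Forms by Example* (2018), §3.10 (proof of Cor. 3.10.2).
* [MoeglinWaldspurger1995] C. Moeglin, J.-L. Waldspurger, *Spectral decomposition and Eisenstein series* (1995), II.1.5.
-/

set_option autoImplicit false
-- the mandated namespace repeats the single-problem summit's segment (`HodgeConjecture.HodgeConjecture`)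
set_option linter.dupNamespace false

noncomputable section

open scoped NNReal ENNReal Pointwise MatrixGroups
open MeasureTheory Measure NumberField IsDedekindDomain Set

namespace Summit.HodgeConjecture.HodgeConjecture.Cruxes.HLiu418.K2LiuGodementParabolicIntegral

open Literature.NumberTheory.Automorphic Literature.MeasureTheory.Group
open Summit.HodgeConjecture.HodgeConjecture.Cruxes.HLiu418.K2LiuGodementSiegelShellIntegral

section Abstract

variable {B : Type*} [Group B] [TopologicalSpace B] [IsTopologicalGroup B] [T2Space B] [SecondCountableTopology B]
  [LocallyCompactSpace B] [MeasurableSpace B] [BorelSpace B]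
  {A N : Subgroup B} {eAN : ↥A × ↥N ≃ₜ B}

/-! ## §1 The module `θ = Δ_B|_A / Δ_A` of the Levi action, read through a chart `φ : G ≃ₜ* A` -/

omit [T2Space B] [SecondCountableTopology B] [MeasurableSpace B] [BorelSpace B] in
/-- **The module of the Levi action as a character of the chart group.**  For an internal semidirect product `B = A ⋉ N` and a
topological-group isomorphism `φ : G ≃ₜ* A`, the function `g ↦ Δ_B(φ g) · Δ_A(φ g)⁻¹` is a monoid homomorphism `G →* ℝ≥0`; by ★
`IsTopSemidirect.map_conjBy_eq_smul` it is the module of `n ↦ (φ g)⁻¹ n (φ g)` on the Haar measures of `N`.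
[cite: Garrett2018, §3.10 (proof of Cor. 3.10.2)] -/
theorem exists_leviModule [LocallyCompactSpace ↥A] {G : Type*} [Group G] [TopologicalSpace G] (φ : G ≃ₜ* ↥A) :
    ∃ Θ : G →* ℝ≥0, ∀ g, Θ g = modularCharacter ((φ g : ↥A) : B) * (modularCharacter (φ g))⁻¹ := by
  refine ⟨{ toFun := fun g => modularCharacter ((φ g : ↥A) : B) * (modularCharacter (φ g))⁻¹,
            map_one' := by simp, map_mul' := fun x y => ?_ }, fun g => rfl⟩
  simp only [map_mul, Subgroup.coe_mul, mul_inv]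
  ring

/-! ## §2 Godement's lemma -/

/-- **GODEMENT'S LEMMA for a parabolic with Levi `GL_k`.**  `B = A ⋉ N` (★ `IsTopSemidirect`), `Γ ≤ B` discrete countable,
`φ : GL_k(𝔸_K) ≃ₜ* A` (`k ≥ 1`) with `φ(GL_k(K)) ⊆ Γ`; `χ` measurable with `χ(a n) = χ a`, `χ(γ b) = χ b`, `χ(φ g) = |det g|ᵉ` (`e > 0`);
`C_N ⊆ N` compact with `∀ n, ∃ γ ∈ Γ ∩ N, γ⁻¹ n ∈ C_N`; a Haar measure `μ_N` on `N` with `((φ z(eˢ))⁻¹ · (φ z(eˢ)))_* μ_N = e^{c₀ s} μ_N`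
(★ `conjBy`); `0 ≤ τ` and `c₀ < k [K:ℚ] e τ`.  Then there are a Haar measure `μ_B` and a `Γ`-covering weight `w` on `B` with
`∫⁻ 𝟙{χ ≤ C₁} χ^τ w dμ_B ≠ ∞` for every `C₁`.  [cite: Godement1964, §8] [cite: Garrett2018, §3.10 (proof of Cor. 3.10.2)]
[cite: MoeglinWaldspurger1995, II.1.5] -/
theorem godement_parabolic_integral (hS : IsTopSemidirect A N eAN) (Γ : Subgroup B) [DiscreteTopology Γ] [Countable Γ]
    (K : Type) [Field K] [NumberField K] {k : ℕ} (hk : 0 < k) (φ : GL (Fin k) (AdeleRing (𝓞 K) K) ≃ₜ* ↥A)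
    (hφΓ : ∀ γ ∈ rationalPointsGL k K, ((φ γ : ↥A) : B) ∈ Γ)
    {χ : B → ℝ} (hχm : Measurable χ) (hχN : ∀ (a : ↥A) (n : ↥N), χ ((a : B) * n) = χ a)
    (hχΓ : ∀ γ ∈ Γ, ∀ b, χ (γ * b) = χ b)
    {eχ : ℝ} (heχ : 0 < eχ) (hχφ : ∀ g, χ ((φ g : ↥A) : B) = ((glAbsDet k K g : ℝ≥0) : ℝ) ^ eχ)
    {CN : Set ↥N} (hCNc : IsCompact CN) (hCN : ∀ n : ↥N, ∃ γ : ↥N, (γ : B) ∈ Γ ∧ γ⁻¹ * n ∈ CN)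
    (μN : Measure ↥N) [IsHaarMeasure μN] {c₀ : ℝ}
    (hscale : ∀ s : ℝ, μN.map (hS.conjBy (φ (scalarExp k K s))) = ENNReal.ofReal (Real.exp (c₀ * s)) • μN)
    {τ : ℝ} (hτ : 0 ≤ τ) (hconv : c₀ < (k * Module.finrank ℚ K : ℕ) * eχ * τ) :
    ∃ (μB : Measure B) (_ : IsHaarMeasure μB) (w : B → ℝ≥0∞), IsCoveringWeight ↥Γ w ∧
      ∀ C₁ : ℝ, ∫⁻ b, {b | χ b ≤ C₁}.indicator (fun b => ENNReal.ofReal (χ b ^ τ)) b * w b ∂μB ≠ ∞ := by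
  classical
  -- instances
  haveI : LocallyCompactSpace ↥A := hS.isClosed_left.locallyCompactSpace
  haveI : LocallyCompactSpace ↥N := hS.isClosed_right.locallyCompactSpace
  haveI : SecondCountableTopology ↥A := TopologicalSpace.Subtype.secondCountableTopology _
  haveI : SecondCountableTopology ↥N := TopologicalSpace.Subtype.secondCountableTopology _
  letI : MeasurableSpace (GL (Fin k) (AdeleRing (𝓞 K) K)) := glAdeleBorel k K
  haveI : BorelSpace (GL (Fin k) (AdeleRing (𝓞 K) K)) := borelSpace_glAdele k K
  haveI : T2Space (GL (Fin k) (AdeleRing (𝓞 K) K)) := t2Space_gl k K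
  haveI : LocallyCompactSpace (GL (Fin k) (AdeleRing (𝓞 K) K)) :=
    AdelicGroupData.locallyCompactSpace_generalLinearGroup_adeleRing K (Fin k)
  haveI : SecondCountableTopology (GL (Fin k) (AdeleRing (𝓞 K) K)) :=
    secondCountableTopology_generalLinearGroup_adeleRing K (Fin k)
  -- the Haar measures: `μ_B`, `ν` on `GL_k(𝔸_K)`, `μ_A = φ_* ν`
  set μB : Measure B := haar with hμB
  set ν : Measure (GL (Fin k) (AdeleRing (𝓞 K) K)) := haar with hν
  set μA : Measure ↥A := ν.map φ with hμA
  haveI : IsHaarMeasure μA := φ.isHaarMeasure_map ν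
  -- the covering weight
  obtain ⟨w, hw⟩ := exists_isCoveringWeight Γ
  refine ⟨μB, inferInstance, w, hw, fun C₁ => ?_⟩
  -- §A the module `Θ` of the Levi action and its soft properties
  obtain ⟨Θ, hΘ⟩ := exists_leviModule (B := B) φ
  have hΘne : ∀ g, Θ g ≠ 0 := fun g => by
    rw [hΘ]; exact mul_ne_zero (modularCharacter_ne_zero _) (inv_ne_zero (modularCharacter_ne_zero _))
  have hΘcont : Continuous Θ := by
    have h : Continuous fun g => modularCharacter ((φ g : ↥A) : B) * (modularCharacter (φ g))⁻¹ :=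
      ((continuous_modularCharacter.comp (continuous_subtype_val.comp φ.continuous)).mul
        ((continuous_modularCharacter.comp φ.continuous).inv₀ fun g => modularCharacter_ne_zero _))
    exact h.congr fun g => (hΘ g).symm
  -- `Θ = 1` on `K`
  have hΘK : ∀ κ ∈ standardMaximalCompactGL k K, Θ κ = 1 := by
    intro κ hκ
    have hKc := isCompact_standardMaximalCompactGL k K
    have h1 : modularCharacter ((φ κ : ↥A) : B) = 1 := by
      refine modularCharacter_eq_one_of_mem_isCompact ((standardMaximalCompactGL k K).map (A.subtype.comp φ.toMonoidHom)) ?_ ?_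
      · rw [Subgroup.coe_map]
        exact hKc.image (continuous_subtype_val.comp φ.continuous)
      · exact ⟨κ, hκ, rfl⟩
    have h2 : modularCharacter (φ κ) = 1 := by
      refine modularCharacter_eq_one_of_mem_isCompact ((standardMaximalCompactGL k K).map φ.toMonoidHom) ?_ ?_
      · rw [Subgroup.coe_map]
        exact hKc.image φ.continuous
      · exact ⟨κ, hκ, rfl⟩
    rw [hΘ, h1, h2, inv_one, mul_one]
  -- `Θ = 1` on the Siegel cone (the `k!`-trick)
  have hΘcone : ∀ {t : ℝ}, ∀ a ∈ siegelCone k K t, Θ a = 1 := by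
    intro t a ha
    obtain ⟨b, hprod, -, rfl⟩ := ha
    have hb : ∏ i, b i = 1 := by
      refine Units.ext (NNReal.eq ?_)
      rw [Units.coe_prod, NNReal.coe_prod, Units.val_one, NNReal.coe_one]
      exact hprod
    rw [posRealDiagonal_apply]
    refine map_glDiagonal_eq_one_of_prod_eq_one Θ (fun x m hm hx => (pow_eq_one_iff_of_nonneg (by positivity) hm.ne').1 hx) _ ?_
    rw [← map_prod (posRealIdele K) b Finset.univ, hb, map_one]
  -- `Θ (z(eˢ)) = e^{c₀ s}`
  have hΘz : ∀ s : ℝ, (Θ (scalarExp k K s) : ℝ) = Real.exp (c₀ * s) := by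
    intro s
    have h1 := hS.map_conjBy_eq_smul μN (φ (scalarExp k K s))
    rw [hscale s] at h1
    -- compare the two scalars on a compact neighbourhood of `1`
    obtain ⟨Kc, hKc, h1K⟩ := exists_compact_mem_nhds (1 : ↥N)
    have h0 : μN (interior Kc) ≠ 0 := (isOpen_interior.measure_pos μN ⟨1, mem_interior_iff_mem_nhds.2 h1K⟩).ne'
    have htop : μN (interior Kc) ≠ ∞ := (lt_of_le_of_lt (measure_mono interior_subset) hKc.measure_lt_top).ne
    have h2 := congrArg (fun μ : Measure ↥N => μ (interior Kc)) h1
    simp only [Measure.smul_apply, smul_eq_mul] at h2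
    have h3 : ENNReal.ofReal (Real.exp (c₀ * s)) =
        ((modularCharacter ((φ (scalarExp k K s) : ↥A) : B) * (modularCharacter (φ (scalarExp k K s)))⁻¹ : ℝ≥0) : ℝ≥0∞) :=
      (ENNReal.mul_left_inj h0 htop).1 h2
    rw [hΘ, ← ENNReal.toReal_ofReal (Real.exp_pos (c₀ * s)).le, h3, ENNReal.coe_toReal]
  -- `Θ` is bounded below on `Ω̄` by a positive constant: done after reduction theory
  -- §B reduction theory for the Levi
  haveI : T2Space (AdeleRing (𝓞 K) K) := t2Space_adeleRing K
  obtain ⟨Ω, t, ht, hΩsub, hΩc, hred⟩ := (reductionTheory_gl_holds k K).exists_mul_eq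
  have hΩB : closure Ω ⊆ (standardParabolicGL (AdeleRing (𝓞 K) K) (id : Fin k → Fin k) : Set (GL (Fin k) (AdeleRing (𝓞 K) K))) :=
    closure_minimal (hΩsub.trans upperUnitriangular_mul_normOneDiagonal_subset) (standardParabolicGL_isClosed (id : Fin k → Fin k))
  set S₀ : Set (GL (Fin k) (AdeleRing (𝓞 K) K)) :=
    closure Ω * siegelCone k K t * (standardMaximalCompactGL k K : Set (GL (Fin k) (AdeleRing (𝓞 K) K))) with hS₀
  set SM : Set (GL (Fin k) (AdeleRing (𝓞 K) K)) := Set.range (scalarExp k K) * S₀ with hSM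
  have hSMm : MeasurableSet SM := measurableSet_range_scalarExp_mul_siegel hΩc ht
  -- lower bound of `Θ` on `Ω̄`
  obtain ⟨m, hm, hmΩ⟩ : ∃ m : ℝ, 0 < m ∧ ∀ ω ∈ closure Ω, m ≤ (Θ ω : ℝ) := by
    rcases (closure Ω).eq_empty_or_nonempty with h | hne
    · exact ⟨1, one_pos, fun ω hω => by rw [h] at hω; exact absurd hω (Set.notMem_empty ω)⟩
    · obtain ⟨ω₀, -, hmin⟩ := hΩc.exists_isMinOn hne (NNReal.continuous_coe.comp hΘcont).continuousOn
      exact ⟨(Θ ω₀ : ℝ), NNReal.coe_pos.2 (pos_iff_ne_zero.2 (hΘne ω₀)), fun ω hω => hmin hω⟩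
  -- `Θ` on `S₀`: `Θ (ω a κ) = Θ ω ≥ m`
  have hΘS₀ : ∀ g ∈ S₀, m ≤ (Θ g : ℝ) := by
    rintro g ⟨_, ⟨ω, hω, a, ha, rfl⟩, κ, hκ, rfl⟩
    rw [map_mul, map_mul, hΘcone a ha, hΘK κ hκ, mul_one, mul_one]
    exact hmΩ ω hω
  -- the decay of `ψ = (Θ ·)⁻¹` along the centre
  set ψ : GL (Fin k) (AdeleRing (𝓞 K) K) → ℝ≥0∞ := fun x => (((Θ x)⁻¹ : ℝ≥0) : ℝ≥0∞) with hψ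
  have hψbound : ∀ (s : ℝ) (g : GL (Fin k) (AdeleRing (𝓞 K) K)), g ∈ S₀ →
      ψ (scalarExp k K s * g) ≤ ENNReal.ofReal (m⁻¹ * Real.exp (-(c₀ * s))) := by
    intro s g hg
    have hpos : 0 < Real.exp (c₀ * s) * (Θ g : ℝ) := mul_pos (Real.exp_pos _) (hm.trans_le (hΘS₀ g hg))
    have hreal : (((Θ (scalarExp k K s * g))⁻¹ : ℝ≥0) : ℝ) ≤ m⁻¹ * Real.exp (-(c₀ * s)) := by
      rw [NNReal.coe_inv, map_mul, NNReal.coe_mul, hΘz s]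
      calc (Real.exp (c₀ * s) * (Θ g : ℝ))⁻¹ ≤ (Real.exp (c₀ * s) * m)⁻¹ := by
            refine inv_anti₀ (mul_pos (Real.exp_pos _) hm) ?_
            exact mul_le_mul_of_nonneg_left (hΘS₀ g hg) (Real.exp_pos _).le
        _ = m⁻¹ * Real.exp (-(c₀ * s)) := by rw [mul_inv, Real.exp_neg, mul_comm]
    rw [hψ]
    dsimp only
    rw [← ENNReal.ofReal_coe_nnreal]
    exact ENNReal.ofReal_le_ofReal hreal
  -- §C the covering set `S ⊆ B`
  set pA : B → ↥A := fun b => (eAN.symm b).1 with hpA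
  set pN : B → ↥N := fun b => hS.conjBy (eAN.symm b).1⁻¹ (eAN.symm b).2 with hpN
  have hpAc : Continuous pA := continuous_fst.comp eAN.symm.continuous
  have hpNc : Continuous pN := by
    refine continuous_induced_rng.2 ?_
    have : (Subtype.val ∘ pN) = fun b => (((eAN.symm b).1 : ↥A) : B) * (((eAN.symm b).2 : ↥N) : B) * (((eAN.symm b).1 : ↥A) : B)⁻¹ := by
      funext b
      simp only [Function.comp_apply, hpN, IsTopSemidirect.conjBy, Subgroup.coe_inv, inv_inv]
    rw [this]
    exact ((continuous_subtype_val.comp hpAc).mul (continuous_subtype_val.comp (continuous_snd.comp eAN.symm.continuous))).mul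
      (continuous_subtype_val.comp hpAc).inv
  set S : Set B := pA ⁻¹' (φ '' SM) ∩ pN ⁻¹' CN with hSdef
  have hφSM : MeasurableSet (φ '' SM) := φ.toHomeomorph.measurableEmbedding.measurableSet_image.2 hSMm
  have hCNm : MeasurableSet CN := hCNc.isClosed.measurableSet
  have hSm : MeasurableSet S := (hφSM.preimage hpAc.measurable).inter (hCNm.preimage hpNc.measurable)
  -- semidirect coordinates of `a * n`
  have hsymm : ∀ (a : ↥A) (n : ↥N), eAN.symm ((a : B) * n) = (a, n) := fun a n => by
    rw [← hS.apply_eq, Homeomorph.symm_apply_apply]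
  have hpA_mul : ∀ (a : ↥A) (n : ↥N), pA ((a : B) * n) = a := fun a n => by simp only [hpA, hsymm]
  have hpN_mul : ∀ (a : ↥A) (n : ↥N), pN ((a : B) * n) = hS.conjBy a⁻¹ n := fun a n => by simp only [hpN, hsymm]
  have hmemS : ∀ (a : ↥A) (n : ↥N), (a : B) * n ∈ S ↔ a ∈ φ '' SM ∧ hS.conjBy a⁻¹ n ∈ CN := fun a n => by
    simp only [hSdef, Set.mem_inter_iff, Set.mem_preimage, hpA_mul, hpN_mul]
  -- every `Γ`-orbit meets `S`
  have hcov : ∀ b : B, ∃ γ : ↥Γ, γ • b ∈ S := by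
    intro b
    set a : ↥A := (eAN.symm b).1 with ha
    set n : ↥N := (eAN.symm b).2 with hn
    have hb : b = (a : B) * n := by
      rw [← hS.apply_eq, show (a, n) = eAN.symm b from rfl, Homeomorph.apply_symm_apply]
    obtain ⟨γ₀, hγ₀, z, hz, ω, hω, a', ha', κ, hκ, hg⟩ := hred (φ.symm a)
    have hzr : z ∈ Set.range (scalarExp k K) := by
      rw [range_scalarExp]
      exact MonoidHom.mem_range.1 hz
    have hsSM : z * ω * a' * κ ∈ SM := by
      refine ⟨z, hzr, ω * a' * κ, ⟨_, ⟨ω, subset_closure hω, a', ha', rfl⟩, κ, hκ, rfl⟩, ?_⟩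
      simp only [mul_assoc]
    set sA : ↥A := φ (z * ω * a' * κ) with hsA
    have ha_eq : a = φ γ₀ * sA := by
      rw [hsA, ← map_mul, show γ₀ * (z * ω * a' * κ) = γ₀ * z * ω * a' * κ by simp only [mul_assoc], hg,
        ContinuousMulEquiv.apply_symm_apply]
    obtain ⟨γN, hγN, hc⟩ := hCN (hS.conjBy sA⁻¹ n)
    set c : ↥N := γN⁻¹ * hS.conjBy sA⁻¹ n with hcdef
    have hγmem : ((φ γ₀ : ↥A) : B) * (γN : B) ∈ Γ := Γ.mul_mem (hφΓ γ₀ hγ₀) hγN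
    have key : b = ((φ γ₀ : ↥A) : B) * (γN : B) * ((c : B) * sA) := by
      rw [hb, ha_eq, hcdef]
      simp only [IsTopSemidirect.conjBy, Subgroup.coe_mul, Subgroup.coe_inv, inv_inv]
      group
    refine ⟨⟨((φ γ₀ : ↥A) : B) * (γN : B), hγmem⟩⁻¹, ?_⟩
    rw [Subgroup.smul_def, smul_eq_mul, Subgroup.coe_inv, key, inv_mul_cancel_left, ← hS.coe_mul_conjBy sA c, hmemS]
    refine ⟨⟨_, hsSM, rfl⟩, ?_⟩
    rw [hS.conjBy_conjBy, mul_inv_cancel, hS.conjBy_one]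
    exact hc
  -- §D the integrand, its invariance, and domination by `S`
  set F : B → ℝ≥0∞ := fun b => {b | χ b ≤ C₁}.indicator (fun b => ENNReal.ofReal (χ b ^ τ)) b with hF
  have hFm : Measurable F :=
    (ENNReal.measurable_ofReal.comp (hχm.pow_const τ)).indicator (measurableSet_le hχm measurable_const)
  have hFΓ : ∀ (γ : ↥Γ) (b : B), F (γ • b) = F b := by
    intro γ b
    have hγb : χ (γ • b) = χ b := by rw [Subgroup.smul_def, smul_eq_mul]; exact hχΓ γ γ.2 b
    simp only [hF, Set.indicator, Set.mem_setOf_eq, hγb]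
  haveI : MeasurableConstSMul ↥Γ B := ⟨fun γ => measurable_const_mul (γ : B)⟩
  haveI : SMulInvariantMeasure ↥Γ B μB := ⟨fun γ s' _ => by
    rw [show (fun x : B => γ • x) ⁻¹' s' = (fun x => (γ : B) * x) ⁻¹' s' from rfl, measure_preimage_mul]⟩
  have hcov1 : ∀ b, (1 : ℝ≥0∞) ≤ coveringSum ↥Γ (S.indicator 1) b := by
    intro b
    obtain ⟨γ, hγ⟩ := hcov b
    rw [coveringSum_apply]
    refine le_trans ?_ (ENNReal.le_tsum γ)
    rw [Set.indicator_of_mem hγ, Pi.one_apply]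
  have hdom := lintegral_mul_le_inv_mul_setLIntegral_of_le_coveringSum_indicator μB hFm hFΓ hw.measurable
    (fun x => (hw.coveringSum_eq x).le) hSm one_ne_zero ENNReal.one_ne_top hcov1
  rw [inv_one, one_mul] at hdom
  refine ne_top_of_le_ne_top ?_ hdom
  -- §E the integral over `S` in semidirect coordinates
  obtain ⟨c, -, hctop, hprod⟩ := hS.lintegral_eq_mul_lintegral_prod μA μN μB
  rw [← lintegral_indicator hSm, hprod _ (hFm.indicator hSm)]
  refine ENNReal.mul_ne_top hctop ?_
  -- the `A`-integrand after integrating out `N`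
  set FA : ↥A → ℝ≥0∞ := fun a => F (a : B) with hFA
  set g : ↥A → ℝ≥0∞ := fun a => (φ '' SM).indicator FA a *
    ((((modularCharacter (((a⁻¹ : ↥A)) : B) * (modularCharacter (a⁻¹ : ↥A))⁻¹ : ℝ≥0)) : ℝ≥0∞) * μN CN) with hgdef
  have hinner : ∀ a : ↥A, ∫⁻ n, S.indicator F ((a : B) * n) ∂μN ≤ g a := by
    intro a
    have hpt : ∀ n : ↥N, S.indicator F ((a : B) * n) ≤
        (φ '' SM).indicator FA a * ((hS.conjBy a⁻¹) ⁻¹' CN).indicator 1 n := by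
      intro n
      by_cases h : (a : B) * n ∈ S
      · obtain ⟨h1, h2⟩ := (hmemS a n).1 h
        rw [Set.indicator_of_mem h, Set.indicator_of_mem h1, Set.indicator_of_mem (show n ∈ (hS.conjBy a⁻¹) ⁻¹' CN from h2),
          Pi.one_apply, mul_one, hFA]
        simp only [hF, Set.indicator, Set.mem_setOf_eq, hχN a n]
        exact le_rfl
      · rw [Set.indicator_of_notMem h]
        exact bot_le
    have hpre : MeasurableSet ((hS.conjBy a⁻¹) ⁻¹' CN) := hCNm.preimage (hS.continuous_conjBy_right a⁻¹).measurable
    calc ∫⁻ n, S.indicator F ((a : B) * n) ∂μN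
        ≤ ∫⁻ n, (φ '' SM).indicator FA a * ((hS.conjBy a⁻¹) ⁻¹' CN).indicator 1 n ∂μN := lintegral_mono hpt
      _ = (φ '' SM).indicator FA a * μN ((hS.conjBy a⁻¹) ⁻¹' CN) := by
          rw [lintegral_const_mul _ (measurable_one.indicator hpre), lintegral_indicator_one hpre]
      _ = g a := by
          rw [hgdef]
          dsimp only
          rw [← Measure.map_apply (hS.continuous_conjBy_right a⁻¹).measurable hCNm, hS.map_conjBy_eq_smul μN a⁻¹,
            Measure.smul_apply, smul_eq_mul]
  refine ne_top_of_le_ne_top ?_ (lintegral_mono hinner)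
  -- transport to `GL_k(𝔸_K)` along `φ`
  set Find : GL (Fin k) (AdeleRing (𝓞 K) K) → ℝ≥0∞ := fun x =>
    {x | ((glAbsDet k K x : ℝ≥0) : ℝ) ^ eχ ≤ C₁}.indicator
      (fun x => ENNReal.ofReal ((((glAbsDet k K x : ℝ≥0) : ℝ) ^ eχ) ^ τ)) x with hFind
  have hgφ : ∀ x, g (φ x) = SM.indicator (fun x => Find x * ψ x * μN CN) x := by
    intro x
    rw [hgdef]
    dsimp only
    by_cases hx : x ∈ SM
    · rw [Set.indicator_of_mem (Set.mem_image_of_mem _ hx), Set.indicator_of_mem hx, hFA, hψ]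
      dsimp only
      rw [← map_inv, ← hΘ, map_inv, hF, hFind]
      dsimp only
      simp only [Set.indicator, Set.mem_setOf_eq, hχφ x, mul_assoc]
    · rw [Set.indicator_of_notMem (fun h => hx ((φ.injective.mem_set_image).1 h)), Set.indicator_of_notMem hx, zero_mul]
  have hmapeq : ∫⁻ a, g a ∂μA = ∫⁻ x, g (φ x) ∂ν := by
    rw [hμA]
    exact lintegral_map_equiv g φ.toHomeomorph.toMeasurableEquiv
  rw [hmapeq]
  simp_rw [hgφ]
  rw [lintegral_indicator hSMm]
  have hsplit : ∫⁻ x in SM, Find x * ψ x * μN CN ∂ν = (∫⁻ x in SM, Find x * ψ x ∂ν) * μN CN :=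
    lintegral_mul_const' _ _ hCNc.measure_lt_top.ne
  rw [hsplit]
  refine ENNReal.mul_ne_top ?_ hCNc.measure_lt_top.ne
  exact (setLIntegral_center_mul_siegel_rpow_mul_lt_top k K hk ν hΩc hΩB ht heχ hτ hconv hψbound C₁).ne

end Abstract

end Summit.HodgeConjecture.HodgeConjecture.Cruxes.HLiu418.K2LiuGodementParabolicIntegral

end
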